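import Summits.Ventures.HodgeRepro.Tier3BranchRebasing

/-!
# Tier 3, T3.2 — R-B.4: the sign is EXACTLY constant along a branch line («the sharp (S4)»)
(seat t3-p3, gen 3; continuation of `Tier3BranchRebasing`, which reached the 400-line limit)

Blind re-derivation cell `pub-hodge-repro`, Tier-3 seat `t3-p3` (route/TIER3.md v1.1 §3 row R-B, sub-row R-B.4;
paper: proofs/t3-p3/R2-PINNING-ADDENDUM-2.md §A14(b)).

Paper input (§A14(a), the twist formula — NOT proved here): for a base character `χ_j′` unramified at the split tower
prime `𝔭` and a branch character `δ` (finite order, anticyclotomic, unramified outside `𝔭`),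
`W(χ_j′ δ) = W(χ_j′) · δ(t_j)` with `t_j := [𝔣_j 𝔡]·[(−1)_𝔭]` an element of order `≤ 2` of the branch group `Δ`.
A tower twist `ν ∈ Ξ_𝔭` has `p`-power order, `p` odd; evaluated at an element of order `≤ 2` it is `1`.  Hence
`W(χ_j′ δ ν) = W(χ_j′) · (δν)(t_j) = W(χ_j′) · δ(t_j) = W(χ_j′ δ)`: the root number of a re-based line does not move
along the line at all (the printed (S4), BHTY p0034:L74, says «up to finitely many»).  This file types the algebra:

* `eq_one_of_sq_eq_one_of_odd_pow_eq_one`, `map_eq_one_of_odd_pow_eq_one` — a character of odd order is trivial on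
  `2`-torsion;
* `sign_const_along_line` — `(δ * ν) t = δ t`: the sign of a re-based line is the sign of its base, for every `ν`;
* `forced_branch_sign_along_line` — with `Tier3BranchRebasing.n2Rebase_three_sign`: at every tower twist `ν` the
  N2-forced branch of line `3` has the sign `∏_j δ_j (t_3 * t_j)` of §A14(b).

HONESTY.  Nothing about root numbers is proved; the dictionary «root number of line `j` at branch `δ` = `w_j · δ(t_j)`»
is the paper input.  TIER3.md §3 R-B's verdict (DECLARED) is unchanged.  Nothing here says anything about the status of
the Hodge conjecture for CM abelian varieties, which is NOT proved.
-/

set_option autoImplicit false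

namespace Summit.Ventures.HodgeRepro.T3.R2Pinning

section LineConstancy

variable {Δ M : Type*} [CommGroup Δ] [CommGroup M]

/-- An element of order dividing `2` whose odd power is `1` is itself `1`. -/
theorem eq_one_of_sq_eq_one_of_odd_pow_eq_one {x : M} (h2 : x ^ 2 = 1) {n : ℕ} (hn : Odd n) (h : x ^ n = 1) :
    x = 1 := by
  obtain ⟨k, rfl⟩ := hn
  rw [pow_succ, pow_mul, h2, one_pow, one_mul] at h
  exact h

/-- **A character of odd order is trivial on `2`-torsion**: `ν ^ n = 1` with `n` odd and `t ^ 2 = 1` give `ν t = 1`. -/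
theorem map_eq_one_of_odd_pow_eq_one (ν : Δ →* M) {n : ℕ} (hn : Odd n) (hν : ν ^ n = 1) {t : Δ}
    (ht : t ^ 2 = 1) : ν t = 1 := by
  have h2 : ν t ^ 2 = 1 := by rw [← map_pow, ht, map_one]
  have h : ν t ^ n = 1 := by
    have := congrArg (fun f : Δ →* M => f t) hν
    simpa using this
  exact eq_one_of_sq_eq_one_of_odd_pow_eq_one h2 hn h

/-- **The sign is constant along a branch line**: for a tower twist `ν` of odd order and `t` of order `≤ 2`,
`(δ * ν) t = δ t` — so `W(χ_j′ δ ν) = W(χ_j′ δ)` exactly, for every branch `δ` and every `ν ∈ Ξ_𝔭`. -/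
theorem sign_const_along_line (δ ν : Δ →* M) {n : ℕ} (hn : Odd n) (hν : ν ^ n = 1) {t : Δ}
    (ht : t ^ 2 = 1) : (δ * ν) t = δ t := by
  rw [MonoidHom.mul_apply, map_eq_one_of_odd_pow_eq_one ν hn hν ht, mul_one]

/-- **The forced branch's sign along its line (§A14(b)).**  Witnesses of sign `+1` on lines `0, 1, 2`; then at EVERY
tower twist `ν` of odd order the branch `n2Rebase δ 3 * ν` of line `3` has the sign `∏_j δ_j (t_3 * t_j)`. -/
theorem forced_branch_sign_along_line (δ : Fin 3 → (Δ →* M)) (t : Fin 4 → Δ) (ht : ∀ j, t j ^ 2 = 1)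
    (hw : ∀ i : Fin 3, δ i (t (Fin.castSucc i)) = 1) (ν : Δ →* M) {n : ℕ} (hn : Odd n) (hν : ν ^ n = 1) :
    (n2Rebase δ 3 * ν) (t 3) = δ 0 (t 3 * t 0) * δ 1 (t 3 * t 1) * δ 2 (t 3 * t 2) := by
  rw [sign_const_along_line _ ν hn hν (ht 3)]
  exact n2Rebase_three_sign δ t ht hw

end LineConstancy

end Summit.Ventures.HodgeRepro.T3.R2Pinning
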